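import Summits.HubbardSuperconductivity.HubbardSuperconductivity.Theorems.NodalDiracTwistBridgeNodalToDWaveMomentumLocallyConstant
import Literature.MathematicalPhysics.QuantumLattice.SectorGroundProjContinuity
import Literature.MathematicalPhysics.QuantumLattice.FinDimSpectrumSectorGibbsLimit

/-!
# Route `NodalDiracTwist`, crux `BridgeNodalToDWave` (stmt-HubbardSuperconductivity-10395) —
# helper: limits of sector ground states, sub-sector energies, loop points

Line `birth`, lead c11 (`--supports stmt-HubbardSuperconductivity-10395`); preparatory lemmas for
`…DiracIntraBlock` (holonomy `−1` Dirac points of the nodal-Dirac package are crossings INSIDE a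
symmetry block).  For the spin-twisted torus `H_L(U,φ) = spinTwistedHubbardTorus L U φ` and the
sector `K = szSector N 0`:

* `exists_groundState_at_limit` (registered sub-goal `stub_groundStateAtLimit`) — if unit sector
  ground states at twists `φ_n → p` of a closed disk about `p` all lie in a closed set `S`, then `p`
  carries a unit sector ground state in `S` (compactness of the ground-state graph,
  `isCompact_groundStateGraph`, and closedness of the Rayleigh-minimal description);
* `minEnergyOn_inf_eq_of_groundState_mem` — if a sub-sector `K' ≤ K` contains a sector ground state,
  the two sector energies agree, so the `K'`-ground states are exactly the sector ground states lying
  in `K'` (`groundState_inf_iff`);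
* `loopPoint_mem_disk`, `loopPoint_ne_center` — the vertices of the package's holonomy polygon lie on
  the boundary circle of the disk and are not its centre.

Sources: T. Kato, *Perturbation Theory for Linear Operators* (1966) II §5.1 (continuity of isolated
eigenvectors, here via compactness); H. Tasaki (2020) §2.2 (variational characterisation of sector
energies).  No new definitions, no named facts.
-/

-- the mandated namespace `Summit.<Summit>.<Problem>.Theorems` repeats `HubbardSuperconductivity`
set_option linter.dupNamespace false

noncomputable section

namespace Summit.HubbardSuperconductivity.HubbardSuperconductivity.Theorems.NodalDiracTwist.BridgeNodalToDWave

open Matrix Filter Topology Literature.MathematicalPhysics.QuantumLattice Literature.Probability.LatticeModels HubbardWave0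
open Summit.HubbardSuperconductivity.HubbardSuperconductivity.Theorems.NodalDiracTwist
open scoped ComplexOrder

/-! ### Sub-sector energies -/

section SubSector

variable {ι : Type*} [Fintype ι] [DecidableEq ι]

/-- **A sub-sector containing a sector ground state has the same sector energy.**  If
`K' ≤ K`, the Rayleigh quotient on the unit sphere of `K` is bounded below by `minEnergyOn A K`, and
some unit vector `χ ∈ K'` is an eigenvector of the Hermitian `A` for `minEnergyOn A K`, then
`minEnergyOn A K' = minEnergyOn A K`. Tasaki (2020) §2.2. [folklore] -/
theorem minEnergyOn_inf_eq_of_groundState_mem {A : Matrix ι ι ℂ} (hA : A.IsHermitian)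
    {K K' : Submodule ℂ (ι → ℂ)} (hK'K : K' ≤ K)
    (hlb : ∀ v ∈ K, star v ⬝ᵥ v = 1 → A.minEnergyOn K ≤ (star v ⬝ᵥ A *ᵥ v).re)
    {χ : ι → ℂ} (hχK' : χ ∈ K') (hχ1 : star χ ⬝ᵥ χ = 1)
    (hχeig : A *ᵥ χ = ((A.minEnergyOn K : ℝ) : ℂ) • χ) :
    A.minEnergyOn K' = A.minEnergyOn K := by
  apply le_antisymm
  · have h := minEnergyOn_le_rayleigh_of_mem hA K' hχK' hχ1
    rwa [hχeig, dotProduct_smul, hχ1, smul_eq_mul, mul_one, Complex.ofReal_re] at h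
  · rw [Matrix.minEnergyOn]
    refine le_csInf ⟨_, χ, hχK', hχ1, rfl⟩ ?_
    rintro E ⟨ψ, hψ, hψ1, rfl⟩
    exact hlb ψ (hK'K hψ) hψ1

/-- **Ground states of such a sub-sector are the sector ground states it contains.** [folklore] -/
theorem groundState_inf_iff {A : Matrix ι ι ℂ} (hA : A.IsHermitian)
    {K K' : Submodule ℂ (ι → ℂ)} (hK'K : K' ≤ K)
    (hlb : ∀ v ∈ K, star v ⬝ᵥ v = 1 → A.minEnergyOn K ≤ (star v ⬝ᵥ A *ᵥ v).re)
    {χ : ι → ℂ} (hχK' : χ ∈ K') (hχ1 : star χ ⬝ᵥ χ = 1)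
    (hχeig : A *ᵥ χ = ((A.minEnergyOn K : ℝ) : ℂ) • χ) (ξ : ι → ℂ) :
    (ξ ∈ K' ∧ ξ ≠ 0 ∧ A *ᵥ ξ = ((A.minEnergyOn K' : ℝ) : ℂ) • ξ) ↔
      (ξ ∈ K' ∧ (ξ ∈ K ∧ ξ ≠ 0 ∧ A *ᵥ ξ = ((A.minEnergyOn K : ℝ) : ℂ) • ξ)) := by
  rw [minEnergyOn_inf_eq_of_groundState_mem hA hK'K hlb hχK' hχ1 hχeig]
  exact ⟨fun h => ⟨h.1, hK'K h.1, h.2.1, h.2.2⟩, fun h => ⟨h.1, h.2.2.1, h.2.2.2⟩⟩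

end SubSector

/-! ### Loop points of the holonomy polygon -/

section LoopPoints

/-- The `i`-th vertex of the holonomy polygon lies on the circle of radius `r` about `p`, hence in
the closed disk. [folklore] -/
theorem loopPoint_mem_disk (p : Fin 2 → ℝ) (r θ : ℝ) :
    ((fun ν : Fin 2 => p ν + r * (if ν = 0 then Real.cos θ else Real.sin θ)) 0 - p 0) ^ 2 +
      ((fun ν : Fin 2 => p ν + r * (if ν = 0 then Real.cos θ else Real.sin θ)) 1 - p 1) ^ 2 ≤ r ^ 2 := by
  simp only [if_pos, if_neg one_ne_zero, add_sub_cancel_left]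
  nlinarith [Real.cos_sq_add_sin_sq θ]

/-- … and is not the centre (`r > 0`). [folklore] -/
theorem loopPoint_ne_center (p : Fin 2 → ℝ) {r : ℝ} (θ : ℝ) (hr : 0 < r) :
    (fun ν : Fin 2 => p ν + r * (if ν = 0 then Real.cos θ else Real.sin θ)) ≠ p := by
  intro h
  have h0 := congrFun h 0
  have h1 := congrFun h 1
  simp only [if_pos, if_neg one_ne_zero, add_eq_left, mul_eq_zero, hr.ne', false_or] at h0 h1
  have := Real.cos_sq_add_sin_sq θ
  rw [h0, h1] at this
  norm_num at this

end LoopPoints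

/-! ### Limits of sector ground states -/

section Limit

variable (L : ℕ) [NeZero L]

/-- **Limits of sector ground states are sector ground states.**  Let `φ_n → p` be twists of the
closed disk `|φ - p| ≤ r` and `χ_n` unit `(N, S^z = 0)` sector ground states of `H_L(U,φ_n)` lying
in a closed set `S`.  Then `H_L(U,p)` has a unit sector ground state in `S`.  (The ground-state
graph over the disk is compact, `isCompact_groundStateGraph`; a cluster point of `(φ_n, χ_n)` has
base `p` and is Rayleigh-minimal, hence a ground state.) Kato (1966) II §5.1. [folklore] -/
theorem exists_groundState_at_limit (U : ℝ) (N : ℕ) (p : Fin 2 → ℝ) {r : ℝ} (hr : 0 ≤ r)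
    (S : Set (Fock (Orb (FermionTorus 2 L)))) (hS : IsClosed S)
    (φs : ℕ → (Fin 2 → ℝ)) (hφD : ∀ n, (φs n 0 - p 0) ^ 2 + (φs n 1 - p 1) ^ 2 ≤ r ^ 2)
    (hφp : Tendsto φs atTop (𝓝 p))
    (χs : ℕ → Fock (Orb (FermionTorus 2 L)))
    (hχ : ∀ n, IsGroundStateInSector (spinTwistedHubbardTorus L U (φs n)) N 0 (χs n))
    (h1 : ∀ n, star (χs n) ⬝ᵥ χs n = 1) (hχS : ∀ n, χs n ∈ S) :
    ∃ χ, IsGroundStateInSector (spinTwistedHubbardTorus L U p) N 0 χ ∧ star χ ⬝ᵥ χ = 1 ∧ χ ∈ S := by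
  classical
  -- the sector is nonempty, hence the variational bound holds
  have hp : ∃ s : Finset (Orb (FermionTorus 2 L)), s.card = N ∧ (upPart s).card = (downPart s).card := by
    by_contra hp
    push Not at hp
    obtain ⟨hmem, hne, -⟩ := hχ 0
    exact hne (funext fun s => (mem_szSector_zero_iff_coord N _).1 hmem s fun h => hp s h.1 h.2)
  have hsg := fun φ : Fin 2 → ℝ => sector_groundState (spinTwistedHubbardTorus L U φ)
    (spinTwistedHubbardTorus_isHermitian L U φ)
    (fun s : Finset (Orb (FermionTorus 2 L)) => s.card = N ∧ (upPart s).card = (downPart s).card)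
    hp (fun s s' hs hs' => spinTwistedHubbardTorus_apply_eq_zero L U φ N s s' hs hs')
    (szSector N 0) (mem_szSector_zero_iff_coord N)
  -- the compact ground-state graph over the disk, cut down to `S`
  set G := {x : (Fin 2 → ℝ) × (Fock (Orb (FermionTorus 2 L))) |
      (x.1 0 - p 0) ^ 2 + (x.1 1 - p 1) ^ 2 ≤ r ^ 2 ∧ x.2 ∈ szSector N 0 ∧ star x.2 ⬝ᵥ x.2 = 1 ∧
      spinTwistedHubbardTorus L U x.1 *ᵥ x.2 =
        (((star x.2 ⬝ᵥ spinTwistedHubbardTorus L U x.1 *ᵥ x.2).re : ℝ) : ℂ) • x.2 ∧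
      ∀ ξ ∈ szSector N 0, star ξ ⬝ᵥ ξ = 1 →
        (star x.2 ⬝ᵥ spinTwistedHubbardTorus L U x.1 *ᵥ x.2).re ≤
          (star ξ ⬝ᵥ spinTwistedHubbardTorus L U x.1 *ᵥ ξ).re} with hG
  have hGc : IsCompact G :=
    isCompact_groundStateGraph (szSector N 0) (spinTwistedHubbardTorus L U)
      (continuous_spinTwistedHubbardTorus L U) p hr
  have hG'c : IsCompact (G ∩ Prod.snd ⁻¹' S) := hGc.inter_right (hS.preimage continuous_snd)
  have hmem : ∀ n, (φs n, χs n) ∈ G ∩ Prod.snd ⁻¹' S := fun n =>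
    ⟨⟨hφD n, (hχ n).1, h1 n,
      minimal_of_mulVec_eq_minEnergyOn_smul (szSector N 0) (hsg (φs n)).2 (hχ n).2.2 (h1 n)⟩, hχS n⟩
  obtain ⟨z, hz, σ, hσ, hlim⟩ := hG'c.tendsto_subseq hmem
  -- the base point of the cluster point is `p`
  have hz1 : z.1 = p := by
    have h1' : Tendsto (fun n => (φs (σ n), χs (σ n)).1) atTop (𝓝 z.1) :=
      (continuous_fst.tendsto z).comp hlim
    have h2' : Tendsto (fun n => φs (σ n)) atTop (𝓝 p) := hφp.comp hσ.tendsto_atTop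
    exact tendsto_nhds_unique h1' h2'
  obtain ⟨⟨-, hzK, hz1u, hzeig, hzmin⟩, hzS⟩ := hz
  rw [hz1] at hzeig hzmin
  refine ⟨z.2, ⟨hzK, ne_zero_of_unit hz1u, ?_⟩, hz1u, hzS⟩
  exact mulVec_eq_minEnergyOn_smul_of_minimal (szSector N 0) hzK hz1u hzeig hzmin

/-- **Registered sub-goal `stub_groundStateAtLimit` of crux stmt-HubbardSuperconductivity-10395**
(lead c11, line `birth`): the statement of `exists_groundState_at_limit` with all binders explicit
and all names fully qualified. Kato (1966) II §5.1. [folklore] -/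
theorem stub_groundStateAtLimit : ∀ (L : ℕ) [NeZero L] (U : ℝ) (N : ℕ) (p : Fin 2 → ℝ) (r : ℝ), 0 ≤ r → ∀ (S : Set (Literature.MathematicalPhysics.QuantumLattice.Fock (Literature.MathematicalPhysics.QuantumLattice.Orb (Literature.MathematicalPhysics.QuantumLattice.FermionTorus 2 L)))), IsClosed S → ∀ (φs : ℕ → (Fin 2 → ℝ)), (∀ n, (φs n 0 - p 0) ^ 2 + (φs n 1 - p 1) ^ 2 ≤ r ^ 2) → Filter.Tendsto φs Filter.atTop (nhds p) → ∀ (χs : ℕ → Literature.MathematicalPhysics.QuantumLattice.Fock (Literature.MathematicalPhysics.QuantumLattice.Orb (Literature.MathematicalPhysics.QuantumLattice.FermionTorus 2 L))), (∀ n, Literature.MathematicalPhysics.QuantumLattice.IsGroundStateInSector (Literature.MathematicalPhysics.QuantumLattice.spinTwistedHubbardTorus L U (φs n)) N 0 (χs n)) → (∀ n, star (χs n) ⬝ᵥ χs n = 1) → (∀ n, χs n ∈ S) → ∃ χ, Literature.MathematicalPhysics.QuantumLattice.IsGroundStateInSector (Literature.MathematicalPhysics.QuantumLattice.spinTwistedHubbardTorus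 L U p) N 0 χ ∧ star χ ⬝ᵥ χ = 1 ∧ χ ∈ S :=
  fun L _ U N p _ hr S hS φs hφD hφp χs hχ h1 hχS =>
    exists_groundState_at_limit L U N p hr S hS φs hφD hφp χs hχ h1 hχS

end Limit

end Summit.HubbardSuperconductivity.HubbardSuperconductivity.Theorems.NodalDiracTwist.BridgeNodalToDWave

end
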